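import Literature.AlgebraicGeometry.Modules.LocalFrames
import Literature.AlgebraicGeometry.Modules.FlatSectionsRegular
import HarnessLib

/-!
# Sections of a finite locally free `𝒪_X`-module inherit torsion-freeness from `𝒪_X`

Let `X` be a scheme and `n` an integer such that no group of sections `Γ(X, U)` of the structure
sheaf has `n`-torsion (e.g. `X` flat over `Spec R` with `n` regular in `R`:
`Modules/FlatSectionsRegular`). Then the same holds for every FINITE LOCALLY FREE `𝒪_X`-module `E`
(`Motives.IsFiniteLocallyFree E`: locally `E|_W ≅ 𝒪^I`, `I` finite):

* `eq_zero_of_zsmul_eq_zero_of_frame` — in a frame `e : 𝒪^I ≅ E|_W` (`I` finite) a section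
  `s ∈ Γ(E, V)`, `V ≤ W`, with `n • s = 0` vanishes: its coordinates `λ_i(s) ∈ Γ(X, V)`
  (`Modules/LocalFrames`: `coord`, `eq_sum_coord_smul`) are killed by `n`;
* `eq_zero_of_zsmul_eq_zero_of_isFiniteLocallyFree` — globally, by comparing germs
  (`TopCat.Presheaf.section_ext` for the abelian sheaf underlying `E`);
* `mono_zsmul_id_toSheaf_of_isFiniteLocallyFree` — hence `n • 𝟙` is a monomorphism of the abelian
  sheaf `(SheafOfModules.toSheaf _).obj E` underlying `E` (the sheaf whose `Sheaf.H` is the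
  cohomology `H^b(X, E)` used throughout the tree, e.g. `Motives.hodgeCohomologyOne`,
  `Motives.hodgeCohomology`), via `mono_zsmul_id_of_forall`;
* `mono_p_smul_id_toSheaf_of_flat_witt` — the `p`-adic case: for `𝒳` flat (e.g. smooth) over
  `W(k)` and `E` finite locally free on `𝒳` (e.g. `Ω¹_{𝒳/W}`, `Ωʲ_{𝒳/W}` for `𝒳/W` smooth, by the
  tree's `isLocallyFree_cotangentSheaf_holds` / `hasRank_hodgeSheaf_choose_holds`), `p • 𝟙 E` is
  mono and `Γ(E, U)` has no `p`-torsion — "`Ωʲ_𝒳` is `p`-torsion free" (X. Hu, arXiv:2507.12458,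
  Def. 8.2; Bloch–Esnault–Kerz 2014, §8), the hypothesis of the staircase / Bockstein packages
  `Algebra/Homology/StaircaseTorsionFree`, `Algebra/Homology/ExtCokernelBockstein`.

Sources: The Stacks project, Tag 01C6 (locally free modules) with Tag 00HI; Hartshorne II.5.
Everything is proved; no named facts. NOT here: quasi-coherent flat modules in general.
-/

noncomputable section

namespace Literature.AlgebraicGeometry.Modules

open CategoryTheory CategoryTheory.Limits _root_.AlgebraicGeometry Opposite TopologicalSpace
open Literature.AlgebraicGeometry.Motives

universe u

variable {X : Scheme.{u}}

/-! ## 1. In a frame -/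

section Frame

variable {E : X.Modules} {W V : X.Opens} {I : Type u}
  (e : SheafOfModules.free I ≅ E.over W) (k : V ⟶ W)

/-- Coordinates in a frame are additive in the section: `λ_i(n • s) = n • λ_i(s)`. [folklore] -/
theorem coord_zsmul (n : ℤ) (s : Γ(E, V)) (i : I) :
    coord e k (n • s) i = n • coord e k s i := by
  let φ : Γ(E, V) →+ Γ(X, V) :=
    AddMonoidHom.mk' (fun t => coord e k t i) (fun t t' => by
      simp only [coord_def]
      exact appLE_add_right _ k t t')
  exact map_zsmul φ n s

/-- **In a frame `𝒪^I ≅ E|_W` (`I` finite), `E` has no more `n`-torsion than `𝒪_X`**: if `Γ(X, V)`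
has no `n`-torsion then a section `s ∈ Γ(E, V)`, `V ≤ W`, with `n • s = 0` is zero (expand
`s = ∑ λ_i(s) b_i`; each coordinate is killed by `n`). [cite: StacksProject, Tag 01C6] -/
theorem eq_zero_of_zsmul_eq_zero_of_frame [Fintype I] (e : SheafOfModules.free I ≅ E.over W)
    (k : V ⟶ W) (n : ℤ) (hO : ∀ a : Γ(X, V), n • a = 0 → a = 0)
    (s : Γ(E, V)) (hs : n • s = 0) : s = 0 := by
  rw [eq_sum_coord_smul e k s]
  refine Finset.sum_eq_zero fun i _ => ?_
  have h0 : coord e k (n • s) i = 0 := by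
    rw [hs, coord_def, appLE_zero_right]
    rfl
  have hc : coord e k s i = 0 := hO _ (by rw [← coord_zsmul, h0])
  rw [hc, zero_smul]

end Frame

/-! ## 2. Finite locally free modules -/

section LocallyFree

variable {E : X.Modules}

/-- **A finite locally free `𝒪_X`-module has no more `n`-torsion than `𝒪_X`.** If no `Γ(X, U)` has
`n`-torsion, then no `Γ(E, U)` has: a section killed by `n` vanishes in every local frame
(`eq_zero_of_zsmul_eq_zero_of_frame`), so all its germs vanish, so it is zero.
[cite: StacksProject, Tag 01C6] -/
theorem eq_zero_of_zsmul_eq_zero_of_isFiniteLocallyFree (hE : IsFiniteLocallyFree E) (n : ℤ)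
    (hO : ∀ (U : X.Opens) (a : Γ(X, U)), n • a = 0 → a = 0) (U : X.Opens) (s : Γ(E, U))
    (hs : n • s = 0) : s = 0 := by
  apply TopCat.Presheaf.section_ext (⟨E.presheaf, E.isSheaf⟩ : TopCat.Sheaf Ab X) U s 0
  intro x hx
  obtain ⟨W, hxW, I, hI, ⟨e⟩⟩ := hE x
  haveI := Fintype.ofFinite I
  have key : E.presheaf.map (homOfLE (inf_le_left : U ⊓ W ≤ U)).op s = 0 := by
    refine eq_zero_of_zsmul_eq_zero_of_frame e (homOfLE inf_le_right) n (hO _) _ ?_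
    have h2 := congrArg (E.presheaf.map (homOfLE (inf_le_left : U ⊓ W ≤ U)).op) hs
    rw [map_zsmul, map_zero] at h2
    exact h2
  change E.presheaf.germ U x hx s = E.presheaf.germ U x hx 0
  rw [← TopCat.Presheaf.germ_res_apply E.presheaf (homOfLE (inf_le_left : U ⊓ W ≤ U)) x
    ⟨hx, hxW⟩ s, key, map_zero, map_zero]

/-- **`n • 𝟙 E` is mono for `E` finite locally free** when no `Γ(X, U)` has `n`-torsion: the
abelian sheaf `(SheafOfModules.toSheaf _).obj E` underlying `E` (whose `Sheaf.H` is `H^b(X, E)`)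
has `n • 𝟙` a monomorphism. [cite: StacksProject, Tag 01C6] -/
theorem mono_zsmul_id_toSheaf_of_isFiniteLocallyFree (hE : IsFiniteLocallyFree E) (n : ℤ)
    (hO : ∀ (U : X.Opens) (a : Γ(X, U)), n • a = 0 → a = 0) :
    Mono (n • 𝟙 ((SheafOfModules.toSheaf X.ringCatSheaf).obj E)) := by
  apply mono_zsmul_id_of_forall
  intro U s hs
  exact eq_zero_of_zsmul_eq_zero_of_isFiniteLocallyFree hE n hO U.unop s hs

end LocallyFree

/-! ## 3. Flat base: `X ⟶ Spec R` flat, `n` regular in `R`; the Witt-vector case -/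

section FlatBase

variable {R : CommRingCat.{u}} (f : X ⟶ Spec R) [Flat f] {E : X.Modules}

include f

/-- For `X ⟶ Spec R` flat, `n` regular in `R` and `E` finite locally free on `X`: no `Γ(E, U)` has
`n`-torsion. [cite: StacksProject, Tag 01C6] -/
theorem eq_zero_of_zsmul_eq_zero_of_isFiniteLocallyFree_of_flat (hE : IsFiniteLocallyFree E)
    (n : ℤ) (hn : IsRegular (n : R)) (U : X.Opens) (s : Γ(E, U)) (hs : n • s = 0) : s = 0 :=
  eq_zero_of_zsmul_eq_zero_of_isFiniteLocallyFree hE n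
    (fun U a ha => eq_zero_of_zsmul_eq_zero f n hn U a ha) U s hs

/-- For `X ⟶ Spec R` flat, `n` regular in `R` and `E` finite locally free on `X`: `n • 𝟙` is a
monomorphism of the abelian sheaf underlying `E`. [cite: StacksProject, Tag 01C6] -/
theorem mono_zsmul_id_toSheaf_of_flat (hE : IsFiniteLocallyFree E) (n : ℤ)
    (hn : IsRegular (n : R)) :
    Mono (n • 𝟙 ((SheafOfModules.toSheaf X.ringCatSheaf).obj E)) :=
  mono_zsmul_id_toSheaf_of_isFiniteLocallyFree hE n
    (fun U a ha => eq_zero_of_zsmul_eq_zero f n hn U a ha)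

end FlatBase

section Witt

variable {p : ℕ} [Fact p.Prime] {k : Type u} [CommRing k] [IsDomain k] [CharP k p]
  {𝒳 : Scheme.{u}} (f : 𝒳 ⟶ Spec (CommRingCat.of (WittVector p k))) [Flat f] {E : 𝒳.Modules}

include f

/-- **`Γ(E, U)` has no `p`-torsion** for `E` finite locally free on a scheme `𝒳` flat (e.g. smooth)
over `W(k)` — e.g. `E = Ωʲ_{𝒳/W}` for `𝒳/W` smooth ("`Ωʲ_𝒳` is `p`-torsion free", X. Hu,
arXiv:2507.12458, Def. 8.2). [cite: StacksProject, Tag 01C6] -/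
theorem eq_zero_of_p_smul_eq_zero_of_isFiniteLocallyFree_of_flat_witt (hE : IsFiniteLocallyFree E)
    (U : 𝒳.Opens) (s : Γ(E, U)) (hs : (p : ℤ) • s = 0) : s = 0 :=
  eq_zero_of_zsmul_eq_zero_of_isFiniteLocallyFree_of_flat f hE (p : ℤ)
    (WittVector.isRegular_intCast_p p k) U s hs

/-- **`p • 𝟙 E` is mono** for `E` finite locally free on `𝒳` flat (e.g. smooth) over `W(k)`: the
hypothesis `Mono ((p : ℤ) • 𝟙 _)` of the staircase term identification
(`Algebra/Homology/StaircaseTorsionFree`) and of the Bockstein package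
(`Algebra/Homology/ExtCokernelBockstein`, `Sheaf.H.map_cokernel_π_pow_surjective`) for the Hodge
sheaves of a smooth `𝒳/W(k)`. [cite: StacksProject, Tag 01C6] -/
theorem mono_p_smul_id_toSheaf_of_flat_witt (hE : IsFiniteLocallyFree E) :
    Mono ((p : ℤ) • 𝟙 ((SheafOfModules.toSheaf 𝒳.ringCatSheaf).obj E)) :=
  mono_zsmul_id_toSheaf_of_flat f hE (p : ℤ) (WittVector.isRegular_intCast_p p k)

end Witt

end Literature.AlgebraicGeometry.Modules
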